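import Literature.MathematicalPhysics.QuantumFieldTheory.OSLocality
import Literature.MathematicalPhysics.QuantumLattice.BargmannHallWightmanHolds
import Literature.Analysis.Distribution.FourierLaplaceEdgeGrowth
import HarnessLib

/-!
# Locality (R3) of the Osterwalder–Schrader boundary values: the unconditional forms

Topic `Literature/MathematicalPhysics/QuantumFieldTheory`; closing file of the decomposition of the named
fact `Literature.MathematicalPhysics.QuantumFieldTheory.OS1973_local` (conjunct (A₃, R3) of
`os_reconstruction`, `WightmanProofs`; Osterwalder–Schrader I (1973), §4.5 "Locality", p. 97).

`OSLocality` proves `OS1973_local_of_facts : (A₁₂⁺) → FL → BHW → OS1973_local` from three named facts.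
Two of them are now theorems of the tree —

* FL, the Fourier–Laplace representation of a tempered distribution with spectrum in a cone together
  with the growth estimate at the edge of the tube
  (`Literature.Analysis.Distribution.fourierLaplace_coneSupport_edgeGrowth_holds`, Streater–Wightman
  Thm. 2-10 (2-80));
* BHW, the Bargmann–Hall–Wightman theorem
  (`Literature.MathematicalPhysics.QuantumLattice.exists_extension_extendedForwardTube_holds`,
  Streater–Wightman Thm. 2-11) —

and this file plugs them in. Results:

* `IsOSContinuationFamily.isLocalFamily_of_hasEdgeGrowth`: an OS continuation family whose
  continuations have polynomial growth at the edge of `𝒯ₙ` is local (E1, E3, BHW);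
* `IsOSContinuationFamily.isLocalFamily_of_hasSpectralCondition`: for OS continuation families the
  spectral condition (b) implies locality (d) (FL supplies the edge growth);
* `IsOSContinuationFamily.isLocalFamily_of_fourierSupportedIn_halfSpectralSet` and the named fact
  **`OS1973_local_halfSpace`, discharged** (`OS1973_local_halfSpace_holds`): §4.5 *as printed*, i.e. for
  the continuation of OS I (4.12)–(4.13), whose Fourier transform `W̃ₙ` is supported in the half-spaces
  `{q_k⁰ ≥ 0}` (p. 93) — in H21's vocabulary `FourierSupportedIn (𝒲 n k) (halfSpectralSet d n)`; the
  proved Lorentz invariance upgrades the support to the spectral set, FL gives the edge growth, and the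
  local tube argument of `OSLocalTube`/`OSLocality` gives (R3);
* `OS1973_local_of_halfSpace : OS1975_exists_continuation_halfSpace → OS1973_local` and
  `OS1973_local_of_spectralCondition : OS1973_spectralCondition → OS1973_local`: the tree's fact
  `OS1973_local` now rests on the analytic core (A₁₂⁺) of OS II alone (equivalently, on (R5));
* `os_reconstruction_of_halfSpace`: `os_reconstruction` from (A₁₂⁺), (e) positivity and (f) the
  cluster property.

## Why `OS1973_local` itself is not discharged here (faithfulness note)

`OS1973_local` quantifies over *every* OS continuation family `𝒲` of `S` (`IsOSContinuationFamily`: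
holomorphy on `𝒯ₙ`, ray-wise distributional boundary values, Euclidean restriction `𝔖ₙ`). OS's §4.5
argument — and the tree's formalisation of it — needs in addition the polynomial growth of `𝔚ₙ` at the
edge of the tube (to take boundary values of the Bargmann–Hall–Wightman continuation on the local permuted
tube, Hörmander Thm. 3.1.15), which OS have for free because their `𝔚ₙ` *is* the Fourier–Laplace
transform (4.12) of `W̃ₙ ∈ 𝒮'` supported in `{q_k⁰ ≥ 0}`. Since the OS continuation family is unique
(`IsOSContinuationFamily.unique`) and, under E0', exists with this representation (OS II, §IV.2 — the
named fact `OS1975_exists_continuation_halfSpace`), `OS1973_local` follows from (A₁₂⁺)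
(`OS1973_local_of_halfSpace`); the statement faithful to §4.5 alone is `OS1973_local_halfSpace`.

## References

* K. Osterwalder, R. Schrader, *Axioms for Euclidean Green's functions*, Comm. Math. Phys. 31 (1973)
  83–112: §4.1 eqs. (4.12)–(4.13) and p. 93 (support of `W̃ₙ`); §4.5 p. 97. [OsterwalderSchraderCMP1973]
* K. Osterwalder, R. Schrader, *Axioms for Euclidean Green's functions II*, Comm. Math. Phys. 42 (1975)
  281–305, §IV.1 Theorem E'→R', §IV.2. [OsterwalderSchraderCMP1975]
* R. F. Streater, A. S. Wightman, *PCT, Spin and Statistics, and All That* (1964), Thms. 2-10, 2-11,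
  §3-3 (3-27). [StreaterWightman1964]
-/

noncomputable section

open MeasureTheory Filter Complex Set
open _root_.Topology
open scoped SchwartzMap
open Literature.MathematicalPhysics.QuantumLattice Literature.MathematicalPhysics.QuantumFieldTheory
open Literature.Analysis.Distribution Literature.Analysis.FunctionSpaces

namespace Literature.MathematicalPhysics.QuantumFieldTheory

variable {d : ℕ}

/-! ### Locality of OS continuation families, unconditionally in BHW and FL -/

/-- **Locality of an OS continuation family with edge growth** (Osterwalder–Schrader I (1973), §4.5:
symmetric continuation from (E3), Bargmann–Hall–Wightman, Jost's theorem; here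
`IsOSContinuationFamily.isLocalFamily_of_edgeGrowth` of `OSLocality` with the Bargmann–Hall–Wightman
theorem supplied by `exists_extension_extendedForwardTube_holds`): for an OS family `S` (E1 and E3 are
used) and a family `𝒲` of boundary values of functions `𝔚ₙ` holomorphic on `𝒯ₙ` with Euclidean
restriction `𝔖ₙ` and polynomial growth at the edge of the tube (`HasEdgeGrowth`), `𝒲` has property (d).
[cite: OsterwalderSchraderCMP1973, §4.5 (p. 97)] -/
theorem IsOSContinuationFamily.isLocalFamily_of_hasEdgeGrowth [NeZero d]
    {S : SchwingerFamily (EuclideanSpace ℝ (Fin (d + 1)))} {𝒲 : WightmanFamily d Unit}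
    (hOS : S.IsOSFamily)
    (hcont : ∀ n : ℕ, ∃ 𝔚 : (Fin n → Fin (d + 1) → ℂ) → ℂ,
      DifferentiableOn ℂ 𝔚 (forwardTube d n) ∧
      HasDistributionalBoundaryValue 𝔚 (𝒲 n fun _ => ()) ∧
      (∀ F : 𝓢((Fin n → EuclideanSpace ℝ (Fin (d + 1))), ℂ), IsTimeOrdered F →
        S n F = ∫ x : Fin n → EuclideanSpace ℝ (Fin (d + 1)), 𝔚 (euclideanPoint x) * F x) ∧
      HasEdgeGrowth 𝔚) :
    IsLocalFamily 𝒲 :=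
  IsOSContinuationFamily.isLocalFamily_of_edgeGrowth hOS hcont fun _ =>
    exists_extension_extendedForwardTube_holds

/-- **For OS continuation families the spectral condition (b) implies locality (d).** If `𝒲` is the
OS continuation family of an OS family `S` and has the spectral condition, then each continuation `𝔚ₙ`
coincides with the Fourier–Laplace transform of `𝒲̃ₙ` and so has polynomial growth at the edge
(`hasEdgeGrowth_of_fourierSupportedIn` with `fourierLaplace_coneSupport_edgeGrowth_holds`,
Streater–Wightman Thm. 2-10 (2-80)); then `isLocalFamily_of_hasEdgeGrowth`. Real proof.
[cite: OsterwalderSchraderCMP1973, §4.5 (p. 97)] -/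
theorem IsOSContinuationFamily.isLocalFamily_of_hasSpectralCondition [NeZero d]
    {S : SchwingerFamily (EuclideanSpace ℝ (Fin (d + 1)))} {𝒲 : WightmanFamily d Unit}
    (hOS : S.IsOSFamily) (h𝒲 : IsOSContinuationFamily S 𝒲) (hspec : HasSpectralCondition 𝒲) :
    IsLocalFamily 𝒲 := by
  refine IsOSContinuationFamily.isLocalFamily_of_hasEdgeGrowth hOS fun n => ?_
  obtain ⟨𝔚, h𝔚, hbv, hSn⟩ := h𝒲 n
  exact ⟨𝔚, h𝔚, hbv, hSn, hasEdgeGrowth_of_fourierSupportedIn h𝔚 hbv (hspec n fun _ => ())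
    fourierLaplace_coneSupport_edgeGrowth_holds⟩

/-- **Locality from the half-space support of the Fourier–Laplace representation** (Osterwalder–Schrader
I (1973), §4.5 for the continuation (4.12)–(4.13), whose Fourier transform `W̃ₙ` is "a distribution in
`𝒮'(ℝ^{4n})` with support in `{q₁⁰ ≥ 0, …, qₙ⁰ ≥ 0}`", p. 93): if `𝒲` is the OS continuation family of
an OS family `S` on `ℝ^{d+1}`, `d ≥ 1`, and the Fourier transform of each `𝒲ₙ` is supported in the
half-space spectral set, then `𝒲` is local. Proof: Lorentz invariance of `𝒲` (from E1,
`IsOSContinuationFamily.isLorentzInvariantDistribution`) upgrades the support to the spectral set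
(`WightmanFamily.hasSpectralCondition_of_halfSpace`, OS I p. 93), then
`isLocalFamily_of_hasSpectralCondition`. Real proof. [cite: OsterwalderSchraderCMP1973, §4.5 (p. 97) and §4.1 p. 93] -/
theorem IsOSContinuationFamily.isLocalFamily_of_fourierSupportedIn_halfSpectralSet [NeZero d]
    {S : SchwingerFamily (EuclideanSpace ℝ (Fin (d + 1)))} {𝒲 : WightmanFamily d Unit}
    (hOS : S.IsOSFamily) (h𝒲 : IsOSContinuationFamily S 𝒲)
    (hhalf : ∀ (n : ℕ) (k : Fin n → Unit), FourierSupportedIn (𝒲 n k) (halfSpectralSet d n)) :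
    IsLocalFamily 𝒲 :=
  h𝒲.isLocalFamily_of_hasSpectralCondition hOS
    (𝒲.hasSpectralCondition_of_halfSpace
      (fun n k => h𝒲.isLorentzInvariantDistribution hOS.covariant n k) hhalf)

/-! ### §4.5 as printed: the named fact with OS's hypotheses, discharged -/

/-- **(A₃, R3 — as printed) Locality of the OS boundary values for the continuation with half-space
spectral support** (Osterwalder–Schrader I (1973), §4.5 "Locality", p. 97, for the functions `𝔚ₙ` of
§4.1, eqs. (4.12)–(4.13): the Fourier–Laplace transforms of the distributions `W̃ₙ ∈ 𝒮'` supported in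
`{q_k⁰ ≥ 0}` (p. 93, first sentence after (4.13)); from the symmetry (E3) of the Schwinger functions,
(4.1), (4.12), (4.14), the Bargmann–Hall–Wightman theorem and "a theorem in [Jost], p. 83" the boundary
distributions satisfy (R3)). *Statement in H21's vocabulary.* For a Schwinger family `S` on `ℝ^{d+1}`,
`d ≥ 1`, with `𝔖₀ = 1`, E1–E4 and E0', and a family `𝒲` of tempered distributions which is an OS
continuation family of `S` (`IsOSContinuationFamily`: boundary values of functions holomorphic on `𝒯ₙ`
with Euclidean restriction `𝔖ₙ`) **and whose Fourier transforms are supported in the half-space spectral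
set** `{∑ pⱼ = 0, (∑_{j≤k} pⱼ)⁰ ≥ 0}` (`FourierSupportedIn (𝒲 n k) (halfSpectralSet d n)`, the support
property of OS's `W̃ₙ` in the conventions of `LorentzSpectralSupport`), `𝒲` has property (d)
`IsLocalFamily`. *Relation to `OS1973_local`.* The tree's `OS1973_local` (same cite) omits the support
hypothesis and so quantifies over every OS continuation family with merely ray-wise boundary values; the
printed argument uses the growth of `𝔚ₙ` at the edge of the tube that (4.12) provides, so that statement
is §4.5 *plus* the analytic core of OS II (it follows from `OS1975_exists_continuation_halfSpace` by
uniqueness of the continuation family, `OS1973_local_of_halfSpace`). This def is the statement §4.5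
proves as printed; it is discharged below. [cite: OsterwalderSchraderCMP1973, §4.5 (p. 97) with §4.1 eqs. (4.12)–(4.13), p. 93] -/
def OS1973_local_halfSpace : Prop :=
  ∀ (d : ℕ) [NeZero d] (S : SchwingerFamily (EuclideanSpace ℝ (Fin (d + 1)))),
    S.IsOSFamily → S.HasLinearGrowth → ∀ 𝒲 : WightmanFamily d Unit, IsOSContinuationFamily S 𝒲 →
      (∀ (n : ℕ) (k : Fin n → Unit), FourierSupportedIn (𝒲 n k) (halfSpectralSet d n)) →
        IsLocalFamily 𝒲

/-- **Discharge of `OS1973_local_halfSpace`** (OS I §4.5 as printed): Lorentz invariance from E1, the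
Fourier–Laplace edge growth, the functional equation from E3 + E1 on the permuted tube
(`OSPermutedBoost`), the Bargmann–Hall–Wightman theorem and the local tube argument (`OSLocalTube`,
`OSLocality`) — all theorems of the tree. [cite: OsterwalderSchraderCMP1973, §4.5 (p. 97)] -/
theorem OS1973_local_halfSpace_holds : OS1973_local_halfSpace :=
  fun _ _ _ hS _ _ h𝒲 hhalf => h𝒲.isLocalFamily_of_fourierSupportedIn_halfSpectralSet hS hhalf

/-- `OS1973_local` (every OS continuation family) implies the printed form `OS1973_local_halfSpace`
(forget the support hypothesis). [folklore] -/
theorem OS1973_local_halfSpace_of_local (h : OS1973_local) : OS1973_local_halfSpace :=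
  fun d _ S hS hE0' 𝒲 h𝒲 _ => h d S hS hE0' 𝒲 h𝒲

/-! ### `OS1973_local` from the analytic core of OS II alone -/

/-- **`OS1973_local` from (A₁₂⁺) `OS1975_exists_continuation_halfSpace` alone**: `OS1973_local_of_facts`
(`OSLocality`) with the Fourier–Laplace fact and the Bargmann–Hall–Wightman theorem supplied by
`fourierLaplace_coneSupport_edgeGrowth_holds` and `exists_extension_extendedForwardTube_holds`. The
continuation family in the hypothesis of `OS1973_local` is the one of (A₁₂⁺) by uniqueness
(`IsOSContinuationFamily.unique`). Real proof. [cite: OsterwalderSchraderCMP1973, §4.5 (p. 97)] -/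
theorem OS1973_local_of_halfSpace (hA : OS1975_exists_continuation_halfSpace) : OS1973_local :=
  OS1973_local_of_facts hA (fun _ _ => fourierLaplace_coneSupport_edgeGrowth_holds)
    fun _ _ => exists_extension_extendedForwardTube_holds

/-- **(R5) implies (R3) for the OS boundary values**: among the conjuncts of (A₃)
(`OS1973_isWightmanFamily_of_continuation_of_parts`), the locality fact `OS1973_local` follows from
the spectral-condition fact `OS1973_spectralCondition`
(`IsOSContinuationFamily.isLocalFamily_of_hasSpectralCondition`). Real proof. [folklore] -/
theorem OS1973_local_of_spectralCondition (hR5 : OS1973_spectralCondition) : OS1973_local :=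
  fun d _ S hS hE0' 𝒲 h𝒲 => h𝒲.isLocalFamily_of_hasSpectralCondition hS (hR5 d S hS hE0' 𝒲 h𝒲)

/-! ### Assembly -/

/-- **`os_reconstruction` from (A₁₂⁺) and the two remaining Wightman properties** — (e) positivity
(OS I §4.3) and (f) the cluster property (OS I §4.4) of the OS boundary values: compared with
`os_reconstruction_of_remaining'` (`WightmanProofs`), locality (d) is now a theorem given (A₁₂⁺)
(`OS1973_local_of_halfSpace`); compared with `os_reconstruction_of_facts` (`OSLocality`), the
Fourier–Laplace and Bargmann–Hall–Wightman facts are discharged. Real proof. [cite: OsterwalderSchraderCMP1975, §IV.1 Theorem E'→R'] -/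
theorem os_reconstruction_of_halfSpace (hA : OS1975_exists_continuation_halfSpace)
    (hR2 : OS1973_positiveDefinite) (hR4 : OS1973_cluster) : os_reconstruction :=
  os_reconstruction_of_remaining' hA (OS1973_local_of_halfSpace hA) hR2 hR4

/-- **`os_reconstruction` from (A₁₂), (R5), (R2), (R4)**: the variant of
`os_reconstruction_of_remaining` (`WightmanProofs`) in which locality (R3) has been absorbed into the
spectral condition (R5) (`OS1973_local_of_spectralCondition`). Real proof. [cite: OsterwalderSchraderCMP1975, §IV.2] -/
theorem os_reconstruction_of_continuation_of_spectral (hA₁₂ : OS1975_exists_forwardTube_continuation)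
    (hR5 : OS1973_spectralCondition) (hR2 : OS1973_positiveDefinite) (hR4 : OS1973_cluster) :
    os_reconstruction :=
  os_reconstruction_of_remaining hA₁₂ hR5 (OS1973_local_of_spectralCondition hR5) hR2 hR4

end Literature.MathematicalPhysics.QuantumFieldTheory
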